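import Literature.AlgebraicGeometry.Shioda1981.PairedHodgeSextuples
import Literature.AlgebraicGeometry.Shioda1982.PicardNumberPrimePower
import HarnessLib

/-!
# Shioda 1981, Appendix: `dim 𝓑²(X⁴₂₅) = 185281` — the number of Hodge sextuples at the levels `m = 5ᵏ` and at odd prime level

Topic `Literature/AlgebraicGeometry/Shioda1981` (T. Shioda, Math. Ann. **258** (1981), Appendix p. 79: "the set `𝔅⁴₂₅` has `4·6!`
indecomposable elements which are permutations of `γᵢ` (`1 ≤ i ≤ 4`) and `182400` decomposable elements. By the method of [12], we
have `182401 ≤ dim 𝒞²(X⁴₂₅) ≤ dim 𝓑²(X⁴₂₅) = 185281`"). ASSEMBLY (theorems only, no definition, no named fact, no `sorry`) of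
* `Shioda1981.PairedHodgeSextuples` (`card_isHodge_isPaired_six`: the paired `α ∈ 𝔅⁴ₘ`, odd `m`, number
  `20h + 180h(h−1) + 720·C(h,3)`, `h = (m−1)/2`; `182400` at `m = 25`), and
* `Shioda1982.PicardNumberPrimePower` (`card_hodge_not_paired_five_pow`: the non-paired `α ∈ 𝔅⁴ₘ`, `m = 5ᵏ`, are the
  `6!·(m/5 − 1)` permutations of the `σ_{5,c}`; `2880 = 4·6!` at `m = 25`):
**`card_isHodge_six_five_pow`** (`|𝔅⁴ₘ|` in closed form at every `m = 5ᵏ`), **`card_isHodge_six_twentyfive`**: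
`|𝔅⁴₂₅| + 1 = 185281` — the printed `dim 𝓑²(X⁴₂₅)` (the `+1` being the class of the square of the hyperplane section, i.e. the
invariant part; that identification, like the dimension statement itself, is quoted, not formalised: the file counts characters).
Also (Ran 1980, Prop. 1.8 (i): at PRIME level every Hodge character is paired — tree `FermatCharacter.IsHodge.isPaired`):
**`card_isHodge_six_prime`**, `|𝔅⁴ₚ| = 20h + 180h(h−1) + 720·C(h,3)`, `h = (p−1)/2`, for every odd prime `p` (the closed form is this
formalisation's; it is the count of the classes of the `2`-planes' characters).
Cross-check (cell `pub-hfermat`): `data/hodge_fermat_n4.json` has `rank_hodge = 185281` at `m = 25` and `27929681` at `m = 125`,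
the values of the closed form (examples below), and `rank_hodge − 1 = 15(p−1)³ − 45(p−1)² + 40(p−1)` at all `61` odd primes `p ≤ 300`
(e.g. `1861, 10901, 19921` at `p = 7, 11, 13`); scripts `code/lit/picard/table_vs_paired6.py`, `table_vs_fivepow.py`.

HONEST FRAMING (cell `pub-hfermat`): explicit algebraic cycles for specific Hodge classes on Fermat/Delsarte varieties; residual open
instances listed; no claim on general Hodge. (Nothing here concerns algebraicity of the `2880` classes, which Shioda leaves open on
p. 79 and Aoki 1987 settles; tree: `Aoki1987_claim_pStandard`.)

## References
* [Shioda1981FermatType] T. Shioda, *Algebraic cycles on abelian varieties of Fermat type*, Math. Ann. 258 (1981) 65–80, Appendix p. 79.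
* [Ran1980] Z. Ran, *Cycles on Fermat hypersurfaces*, Compositio Math. 42 (1980) 121–142, Prop. 1.8 (i) (tree: `IsHodge.isPaired`).
-/

noncomputable section

namespace Literature.AlgebraicGeometry.Shioda1981

open Finset
open Literature.AlgebraicGeometry.HodgeTheory Literature.AlgebraicGeometry.HodgeTheory.FermatCharacter
open Literature.AlgebraicGeometry.Shioda1982

open scoped Classical in
/-- **`|𝔅⁴ₘ|` at `m = 5ᵏ` (`k ≥ 1`)**: with `h = (m−1)/2`,
`|𝔅⁴ₘ| = 20h + 180h(h−1) + 720·C(h,3) + 720·(m/5 − 1)` (paired + permutations of the `σ_{5,c}`). Printed instance `m = 25`: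
`182400 + 2880 = 185280 = dim 𝓑²(X⁴₂₅) − 1`. [cite: Shioda1981FermatType, Appendix (A.1), p. 79] -/
theorem card_isHodge_six_five_pow {k : ℕ} (hk : 0 < k) :
    (univ.filter fun α : Fin 6 → ZMod (5 ^ k) ↦ IsHodge α).card =
      20 * ((5 ^ k - 1) / 2) + 180 * ((5 ^ k - 1) / 2 * ((5 ^ k - 1) / 2 - 1)) + 720 * ((5 ^ k - 1) / 2).choose 3 +
        720 * (5 ^ k / 5 - 1) := by
  classical
  haveI : NeZero (5 ^ k) := ⟨pow_ne_zero _ (by norm_num)⟩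
  have hodd : ¬ 2 ∣ 5 ^ k := by
    intro h
    have := Nat.Prime.dvd_of_dvd_pow Nat.prime_two h
    omega
  have h1 : (univ.filter fun α : Fin 6 → ZMod (5 ^ k) ↦ IsHodge α ∧ IsPaired α).card =
      20 * ((5 ^ k - 1) / 2) + 180 * ((5 ^ k - 1) / 2 * ((5 ^ k - 1) / 2 - 1)) + 720 * ((5 ^ k - 1) / 2).choose 3 := by
    convert card_isHodge_isPaired_six hodd
  have h2 : (univ.filter fun α : Fin 6 → ZMod (5 ^ k) ↦ IsHodge α ∧ ¬ IsPaired α).card = 720 * (5 ^ k / 5 - 1) := by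
    convert card_hodge_not_paired_five_pow hk
  have hsplit : (univ.filter fun α : Fin 6 → ZMod (5 ^ k) ↦ IsHodge α).card =
      (univ.filter fun α : Fin 6 → ZMod (5 ^ k) ↦ IsHodge α ∧ IsPaired α).card +
        (univ.filter fun α : Fin 6 → ZMod (5 ^ k) ↦ IsHodge α ∧ ¬ IsPaired α).card := by
    rw [← Finset.card_filter_add_card_filter_not (fun α : Fin 6 → ZMod (5 ^ k) ↦ IsPaired α),
      Finset.filter_filter, Finset.filter_filter]
  rw [hsplit, h1, h2]

open scoped Classical in
/-- **Shioda 1981, p. 79: `dim 𝓑²(X⁴₂₅) = 185281`**, i.e. `|𝔅⁴₂₅| = 185280 = 182400 + 2880`.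
[cite: Shioda1981FermatType, Appendix (A.1), p. 79] -/
theorem card_isHodge_six_twentyfive :
    (univ.filter fun α : Fin 6 → ZMod (5 ^ 2) ↦ IsHodge α).card + 1 = 185281 := by
  rw [card_isHodge_six_five_pow (by norm_num)]
  decide

open scoped Classical in
/-- The closed form at `m = 125`: `|𝔅⁴₁₂₅| + 1 = 27929681` (the cell's fourfold table has `rank_hodge = 27929681` at `m = 125`).
[cite: Shioda1981FermatType, Appendix (A.1), p. 79] -/
example : (univ.filter fun α : Fin 6 → ZMod (5 ^ 3) ↦ IsHodge α).card + 1 = 27929681 := by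
  rw [card_isHodge_six_five_pow (by norm_num)]
  decide

open scoped Classical in
/-- **Odd prime level**: every Hodge sextuple of `X⁴ₚ` is paired (Ran 1980, Prop. 1.8 (i); tree `IsHodge.isPaired`), so
`|𝔅⁴ₚ| = 20h + 180h(h−1) + 720·C(h,3)`, `h = (p−1)/2` (`= 15(p−1)³ − 45(p−1)² + 40(p−1)`; the closed form is this formalisation's).
[cite: Ran1980, Prop. 1.8 (i)] [cite: Shioda1981FermatType, Appendix (A.1), p. 79 (the count at composite level 25)] -/
theorem card_isHodge_six_prime {p : ℕ} [Fact p.Prime] (hp2 : p ≠ 2) :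
    (univ.filter fun α : Fin 6 → ZMod p ↦ IsHodge α).card =
      20 * ((p - 1) / 2) + 180 * ((p - 1) / 2 * ((p - 1) / 2 - 1)) + 720 * ((p - 1) / 2).choose 3 := by
  classical
  have hodd : ¬ 2 ∣ p := fun h ↦
    hp2 ((Nat.prime_dvd_prime_iff_eq Nat.prime_two (Fact.out : p.Prime)).mp h).symm
  have h1 : (univ.filter fun α : Fin 6 → ZMod p ↦ IsHodge α ∧ IsPaired α).card =
      20 * ((p - 1) / 2) + 180 * ((p - 1) / 2 * ((p - 1) / 2 - 1)) + 720 * ((p - 1) / 2).choose 3 := by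
    convert card_isHodge_isPaired_six hodd
  rw [← h1]
  congr 1
  exact Finset.filter_congr fun α _ ↦ ⟨fun h ↦ ⟨h, h.isPaired⟩, fun h ↦ h.1⟩

/-- `11` is prime (kernel evaluation, proved once as a lemma so that the instance below is a constant). [folklore] -/
private theorem prime_eleven : Nat.Prime 11 := by decide

/-- `13` is prime. [folklore] -/
private theorem prime_thirteen : Nat.Prime 13 := by decide

open scoped Classical in
/-- `|𝔅⁴₇| + 1 = 1861`, `|𝔅⁴₁₁| + 1 = 10901`, `|𝔅⁴₁₃| + 1 = 19921` (the cell's fourfold table: `rank_hodge` at `m = 7, 11, 13`).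
(The intermediate equalities are stated with the goal's own elaboration of `𝔅⁴ₘ` and proved by the theorem as a term, so that
the kernel never compares two differently synthesised `Fintype` structures on `Fin 6 → ZMod m`.) [cite: Ran1980, Prop. 1.8 (i)] -/
example : (univ.filter fun α : Fin 6 → ZMod 7 ↦ IsHodge α).card + 1 = 1861 ∧
    (univ.filter fun α : Fin 6 → ZMod 11 ↦ IsHodge α).card + 1 = 10901 ∧
    (univ.filter fun α : Fin 6 → ZMod 13 ↦ IsHodge α).card + 1 = 19921 := by
  haveI : Fact (Nat.Prime 7) := ⟨Nat.prime_seven⟩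
  haveI : Fact (Nat.Prime 11) := ⟨prime_eleven⟩
  haveI : Fact (Nat.Prime 13) := ⟨prime_thirteen⟩
  have h7 : (univ.filter fun α : Fin 6 → ZMod 7 ↦ IsHodge α).card =
      20 * ((7 - 1) / 2) + 180 * ((7 - 1) / 2 * ((7 - 1) / 2 - 1)) + 720 * ((7 - 1) / 2).choose 3 :=
    card_isHodge_six_prime (p := 7) (by decide)
  have h11 : (univ.filter fun α : Fin 6 → ZMod 11 ↦ IsHodge α).card =
      20 * ((11 - 1) / 2) + 180 * ((11 - 1) / 2 * ((11 - 1) / 2 - 1)) + 720 * ((11 - 1) / 2).choose 3 :=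
    card_isHodge_six_prime (p := 11) (by decide)
  have h13 : (univ.filter fun α : Fin 6 → ZMod 13 ↦ IsHodge α).card =
      20 * ((13 - 1) / 2) + 180 * ((13 - 1) / 2 * ((13 - 1) / 2 - 1)) + 720 * ((13 - 1) / 2).choose 3 :=
    card_isHodge_six_prime (p := 13) (by decide)
  rw [h7, h11, h13]
  decide

end Literature.AlgebraicGeometry.Shioda1981
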